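import Summits.QuantumFields.BalabanUV.T4Continuum.Spine.NE1p.DressedUniformConstants

/-!
# T⁴ programme, spine estimate NE1′ (node O3b/H2) — row S3 supplement: THE UNIFORM CONSTANTS FOR A GENERAL K-FREE STEP FACTOR
# (rates `ψ·a`, e.g. `a := alphaCell κ ∕ q` of END-F′-geom ∕ the ratio-END at rate `ψ·α∕q`; typer ruling R-T8, leaf-08 F-ne1pleaf08-1 (5))

Cell `pub-balaban`, sub-cell `t4`, BINDER-OWNERS row NE1′, formalisation crew `b2b-balaban-t4-ne1p-formalise-*`, seat `…-leaf-09`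
(holder of row S3).  ADDITIVE — imports `Spine/NE1p/DressedUniformConstants` (row S3, p212599) ONLY; a separate module because the
row-S3 file is at the 400-line cap.

WHY.  Row S3's `locCell` ∕ `LzeroCell` ∕ `uniformConstantsCell` ∕ `bookingLeavesCell` are the INSTANCE `a := alphaCell κ = e³(1+4κ)` of
the per-step transport rate `ψ·a` (with `ψ = L⁻²`).  The K-free repair (R-a) of caveat LF-1 (leaf-08 F-ne1pleaf08-1 (5); typer R-T8;
leaf-01's ratio-END S2c) pays a geometric chart-radius floor IN THE RATE: `ψ·α ↦ ψ·α∕q` for a FIXED K-free `q ∈ (0, 1]`.  So the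
constants must be built for an ARBITRARY K-free step factor `a ≥ 0`; this file does that, word for word as row S3, and shows the
`1∕q` is absorbed by the explicit largeness threshold: `LzeroOf (alphaCell κ ∕ q) η = alphaCell κ ∕ (q·η)` (`LzeroOf_div`) — for
`q = 1∕2`, `κ → 0`, `η → 1⁻` the record's «L > e³» becomes «L > 2e³ ≈ 40.2», exactly leaf-08's arithmetic; NO numeral is taken from
print (caveat k2), every input is a displayed real parameter (caveat k1).

* §1 `rhoOneOf ψ a C c̄ := ψ·a + C·c̄`, `hrate_of` ∕ `hrate_of_bounds_of` (= `BookingLeaves.hrate`'s shape at `ρ := fun _ => ψ·a`);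
  `rhoOne = rhoOneOf _ (alphaCell κ)` (`rfl`).
* §2 `locOf L a C c̄ := a∕L + L·C·c̄`, `prod_of : L⁴·rhoOneOf L⁻² a C c̄·L⁻³ = locOf L a C c̄`; `locCell = locOf _ (alphaCell κ)` (`rfl`).
* §3 `LzeroOf a η := a∕η`, `locOf_le_of_largeL : LzeroOf a η ≤ L → L·C·c̄ ≤ η′ → locOf ≤ η + η′` (needs `0 < L` separately: `a` may
  vanish); `LzeroOf_div` (the `1∕q` absorption); `LzeroCell = LzeroOf (alphaCell κ)` (`rfl`).
* §4 `uniformConstantsOf L a C c̄ N₀ A₀ m s̄⁰ ρ′ …` : `UniformConstants` with `(Λ, ρ₁, τ) = (L⁴, rhoOneOf L⁻² a C c̄, L⁻³)`, field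
  `simp` lemmas; §5 `bookingLeavesOf` (per-cutoff bundle, `hρ`∕`hc`∕`hrate` discharged at `ρ := fun _ => L⁻²·a`) and
  `dressedStability_of_stepFactor` (END-B by name).

HONEST FRAMING.  Kernel arithmetic over displayed binders ([folklore]; 0 sorry; 0 citations used as facts; no `def … : Prop`).
«(w7)∕(w6) ⇐ located largeness + regeneration smallness + window, for any K-free step factor», NEVER «NE1′ proved»; the wall (w1),
(w2-act), (w3)⁺, (w5), F-6's rate (and the q of (R-a)) stands; spine PROVED 0∕9.  Rung (B)+1 on ONE finite four-torus — NOT infinite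
volume, NOT a mass gap, NOT OS on ℝ⁴, NOT Clay.  HONEST DEPENDENCY: continuum YM on T⁴ ⇐ BetaPertH ∧ nine spine estimates (0/9
proved); BetaPertH ⇐ (D1) ∧ (D4) ∧ CAP+tail; G-an2-4 gates asym, D1 and NE2/3/4.
-/

noncomputable section

namespace Summit.QuantumFields.BalabanUV.T4Continuum.NE1p.DressedUniformConstants

open Finset
open scoped BigOperators
open Literature.MathematicalPhysics.QuantumFieldTheory.Balaban1983to89
open Literature.MathematicalPhysics.QuantumFieldTheory.Balaban1983to89.T4TermFormat
open Literature.MathematicalPhysics.QuantumFieldTheory.Balaban1983to89.T4TrajectoryComparison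
open Summit.QuantumFields.BalabanUV.T4Continuum.T4TrajectoryDensityDressed
open Summit.QuantumFields.BalabanUV.T4Continuum.NE1p.DressedRoot

/-! ## §1 The family factor for a general step factor -/

/-- **THE UNIFORM FAMILY FACTOR FOR A STEP FACTOR `a`** [shape]: `rhoOneOf ψ a C c̄ = ψ·a + C·c̄`.  Row S3's `rhoOne` is the
instance `a := alphaCell κ`; END-F′-geom ∕ the ratio-END at rate `ψ·α∕q` takes `a := alphaCell κ ∕ q`.  A number. [folklore] -/
def rhoOneOf (ψ a C cbar : ℝ) : ℝ := ψ * a + C * cbar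

/-- Row S3's family factor is the `alphaCell` instance. [folklore] -/
theorem rhoOne_eq_rhoOneOf (ψ C cbar κ : ℝ) : rhoOne ψ C cbar κ = rhoOneOf ψ (alphaCell κ) C cbar := rfl

/-- Sign. [folklore] -/
theorem rhoOneOf_nonneg {ψ a C cbar : ℝ} (hψ : 0 ≤ ψ) (ha : 0 ≤ a) (hC : 0 ≤ C) (hcbar : 0 ≤ cbar) :
    0 ≤ rhoOneOf ψ a C cbar := by
  unfold rhoOneOf; positivity

/-- **(w7) AT ONE STEP** [arith]: `ψ·a + C·c ≤ rhoOneOf ψ a C c̄` whenever `c ≤ c̄`, `C ≥ 0`. [folklore] -/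
theorem hrate_of {ψ a C cbar c : ℝ} (hC : 0 ≤ C) (hc : c ≤ cbar) : ψ * a + C * c ≤ rhoOneOf ψ a C cbar := by
  unfold rhoOneOf
  have := mul_le_mul_of_nonneg_left hc hC
  linarith

/-- **(w7) IN THE FIELD SHAPE OF `BookingLeaves.hrate`** at the constant rate profile `ρ := fun _ => ψ·a`. [folklore] -/
theorem hrate_of_bounds_of {ψ a C cbar : ℝ} {c : ℕ → ℝ} {K : ℕ} (hC : 0 ≤ C) (hc : ∀ k, k < K → c k ≤ cbar) :
    ∀ k, k < K → (fun _ : ℕ => ψ * a) k + C * c k ≤ rhoOneOf ψ a C cbar :=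
  fun k hk => hrate_of hC (hc k hk)

/-! ## §2 The located quantity for a general step factor -/

/-- **THE LOCATED QUANTITY** [shape]: `locOf L a C c̄ = a∕L + L·C·c̄` — the strict product `Λρ₁τ` at `(Λ, ψ, τ) = (L⁴, L⁻², L⁻³)` for the
step factor `a`.  (w7) is `locOf ≤ ρ′ < 1`; a binder, NOT printed. [folklore] -/
def locOf (L a C cbar : ℝ) : ℝ := a / L + L * C * cbar

/-- Row S3's located quantity is the `alphaCell` instance. [folklore] -/
theorem locCell_eq_locOf (L C cbar κ : ℝ) : locCell L C cbar κ = locOf L (alphaCell κ) C cbar := rfl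

/-- Sign. [folklore] -/
theorem locOf_nonneg {L a C cbar : ℝ} (hL : 0 ≤ L) (ha : 0 ≤ a) (hC : 0 ≤ C) (hcbar : 0 ≤ cbar) : 0 ≤ locOf L a C cbar := by
  unfold locOf; positivity

/-- **THE STRICT PRODUCT IN THE CELL'S NUMBERS** [arith]: `L⁴ · rhoOneOf L⁻² a C c̄ · (L⁻¹)³ = locOf L a C c̄` for `L > 0`. [folklore] -/
theorem prod_of {L a C cbar : ℝ} (hL : 0 < L) : L ^ 4 * rhoOneOf (L ^ 2)⁻¹ a C cbar * L⁻¹ ^ 3 = locOf L a C cbar := by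
  unfold rhoOneOf locOf
  field_simp

/-- The located quantity is monotone in the step factor (so any K-free UPPER bound of a k-dependent profile serves). [folklore] -/
theorem locOf_mono {L a a' C cbar : ℝ} (hL : 0 < L) (h : a ≤ a') : locOf L a C cbar ≤ locOf L a' C cbar := by
  unfold locOf
  have := div_le_div_of_nonneg_right h hL.le
  linarith

/-! ## §3 The explicit largeness threshold for a general step factor -/

/-- **THE EXPLICIT LARGENESS THRESHOLD** [shape]: `LzeroOf a η = a∕η`. [folklore] -/
def LzeroOf (a η : ℝ) : ℝ := a / η

/-- Row S3's threshold is the `alphaCell` instance. [folklore] -/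
theorem LzeroCell_eq_LzeroOf (κ η : ℝ) : LzeroCell κ η = LzeroOf (alphaCell κ) η := rfl

/-- **THE `1∕q` ABSORPTION** [arith]: for the rate `ψ·α∕q` of END-F′-geom (leaf-08 F-ne1pleaf08-1 (5), repair (R-a)) the threshold
is `LzeroOf (a∕q) η = a∕(q·η)` — e.g. `a = e³`, `q = 1∕2`, `η → 1⁻`: `L₀ → 2e³ ≈ 40.2`.  Arithmetic; no numeral asserted. [folklore] -/
theorem LzeroOf_div (a q η : ℝ) : LzeroOf (a / q) η = a / (q * η) := by
  unfold LzeroOf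
  rw [div_div]

/-- **(w7) FROM `L₀ ≤ L` AND THE REGENERATION SMALLNESS** [arith]: `0 < L`, `LzeroOf a η ≤ L` (`η > 0`, `a ≥ 0`) and
`L·C·c̄ ≤ η′` give `locOf L a C c̄ ≤ η + η′`.  (`0 < L` is separate: `a` may vanish.) [folklore] -/
theorem locOf_le_of_largeL {L a C cbar η η' : ℝ} (hL0 : 0 < L) (hη : 0 < η) (hL : LzeroOf a η ≤ L)
    (hreg : L * C * cbar ≤ η') : locOf L a C cbar ≤ η + η' := by
  have h1 : a / L ≤ η := by
    rw [div_le_iff₀ hL0]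
    have := (div_le_iff₀ hη).mp hL
    linarith
  unfold locOf
  linarith

/-! ## §4 The constructor for a general step factor -/

/-- **`uniformConstantsOf` — THE K- AND μ-FREE CONSTANTS FOR THE RATE `ψ·a`, `ψ = L⁻²`** [bookkeeping]: block size `L ≥ 1`, step
factor `a ≥ 0`, transport constant `C ≥ 0`, regeneration bound `c̄ ≥ 0`, multiplicity `N₀ ≥ 0`, amplitude `A₀ ≥ 0`, source factor
`m ≥ 0`, action margin `s̄⁰`, and `ρ′` with the located largeness `locOf L a C c̄ ≤ ρ′ < 1` ((w7)) and the window (w6) — the term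
`U : UniformConstants` with `(Λ, ρ₁, τ) = (L⁴, rhoOneOf L⁻² a C c̄, L⁻³)`.  `uniformConstantsCell` is the instance `a := alphaCell κ`.
Nothing asserted for Bałaban's scheme. [folklore] -/
def uniformConstantsOf (L a C cbar N₀ A₀ m sbar ρ' : ℝ) (hL : 1 ≤ L) (ha : 0 ≤ a) (hC : 0 ≤ C) (hcbar : 0 ≤ cbar)
    (hN₀ : 0 ≤ N₀) (hA₀ : 0 ≤ A₀) (hm : 0 ≤ m) (hloc : locOf L a C cbar ≤ ρ') (hρ'1 : ρ' < 1)
    (hsmall : m * (N₀ * A₀ * (1 - ρ')⁻¹) ≤ 1 - sbar) : UniformConstants where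
  C := C
  A₀ := A₀
  ρ₁ := rhoOneOf (L ^ 2)⁻¹ a C cbar
  τ := L⁻¹ ^ 3
  Λ := L ^ 4
  N₀ := N₀
  ρ' := ρ'
  sbar := sbar
  m := m
  hC := hC
  hA₀ := hA₀
  hρ₁ := rhoOneOf_nonneg (inv_nonneg.mpr (sq_nonneg L)) ha hC hcbar
  hτ0 := tau_cell_nonneg hL
  hτ1 := tau_cell_le_one hL
  hΛ := pow_nonneg (by linarith) 4
  hN₀ := hN₀
  hm := hm
  hρ'1 := hρ'1
  hprod := by rw [prod_of (by linarith)]; exact hloc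
  hsmall := hsmall

section Fields

variable {L a C cbar N₀ A₀ m sbar ρ' : ℝ} {hL : 1 ≤ L} {ha : 0 ≤ a} {hC : 0 ≤ C} {hcbar : 0 ≤ cbar}
  {hN₀ : 0 ≤ N₀} {hA₀ : 0 ≤ A₀} {hm : 0 ≤ m} {hloc : locOf L a C cbar ≤ ρ'} {hρ'1 : ρ' < 1}
  {hsmall : m * (N₀ * A₀ * (1 - ρ')⁻¹) ≤ 1 - sbar}

/-- Field read-out: transport constant. [folklore] -/
@[simp] theorem uniformConstantsOf_C :
    (uniformConstantsOf L a C cbar N₀ A₀ m sbar ρ' hL ha hC hcbar hN₀ hA₀ hm hloc hρ'1 hsmall).C = C := rfl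

/-- Field read-out: class amplitude. [folklore] -/
@[simp] theorem uniformConstantsOf_A₀ :
    (uniformConstantsOf L a C cbar N₀ A₀ m sbar ρ' hL ha hC hcbar hN₀ hA₀ hm hloc hρ'1 hsmall).A₀ = A₀ := rfl

/-- Field read-out: family factor. [folklore] -/
@[simp] theorem uniformConstantsOf_ρ₁ :
    (uniformConstantsOf L a C cbar N₀ A₀ m sbar ρ' hL ha hC hcbar hN₀ hA₀ hm hloc hρ'1 hsmall).ρ₁ =
      rhoOneOf (L ^ 2)⁻¹ a C cbar := rfl

/-- Field read-out: source decay. [folklore] -/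
@[simp] theorem uniformConstantsOf_τ :
    (uniformConstantsOf L a C cbar N₀ A₀ m sbar ρ' hL ha hC hcbar hN₀ hA₀ hm hloc hρ'1 hsmall).τ = L⁻¹ ^ 3 := rfl

/-- Field read-out: positional count rate. [folklore] -/
@[simp] theorem uniformConstantsOf_Λ :
    (uniformConstantsOf L a C cbar N₀ A₀ m sbar ρ' hL ha hC hcbar hN₀ hA₀ hm hloc hρ'1 hsmall).Λ = L ^ 4 := rfl

/-- Field read-out: positional multiplicity. [folklore] -/
@[simp] theorem uniformConstantsOf_N₀ :
    (uniformConstantsOf L a C cbar N₀ A₀ m sbar ρ' hL ha hC hcbar hN₀ hA₀ hm hloc hρ'1 hsmall).N₀ = N₀ := rfl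

/-- Field read-out: strict-product bound. [folklore] -/
@[simp] theorem uniformConstantsOf_ρ' :
    (uniformConstantsOf L a C cbar N₀ A₀ m sbar ρ' hL ha hC hcbar hN₀ hA₀ hm hloc hρ'1 hsmall).ρ' = ρ' := rfl

/-- Field read-out: action margin. [folklore] -/
@[simp] theorem uniformConstantsOf_sbar :
    (uniformConstantsOf L a C cbar N₀ A₀ m sbar ρ' hL ha hC hcbar hN₀ hA₀ hm hloc hρ'1 hsmall).sbar = sbar := rfl

/-- Field read-out: source factor. [folklore] -/
@[simp] theorem uniformConstantsOf_m :
    (uniformConstantsOf L a C cbar N₀ A₀ m sbar ρ' hL ha hC hcbar hN₀ hA₀ hm hloc hρ'1 hsmall).m = m := rfl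

end Fields

/-! ## §5 The per-cutoff bundle and END-B for a general step factor -/

/-- **`BookingLeaves` OVER `uniformConstantsOf` WITH THE ARITHMETIC DISCHARGED** [bookkeeping]: as row S3's `bookingLeavesCell`, at the
constant rate profile `ρ := fun _ => L⁻²·a` — regeneration constants `0 ≤ c k ≤ c̄`, margins, counts at rate `L⁴`, the three gated
leaves displayed UNCHANGED; `hρ`∕`hc`∕`hrate` are theorems. [folklore] -/
def bookingLeavesOf {L a C cbar N₀ A₀ m sbar ρ' : ℝ} (hL : 1 ≤ L) (ha : 0 ≤ a) (hC : 0 ≤ C) (hcbar : 0 ≤ cbar)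
    (hN₀ : 0 ≤ N₀) (hA₀ : 0 ≤ A₀) (hm : 0 ≤ m) (hloc : locOf L a C cbar ≤ ρ') (hρ'1 : ρ' < 1)
    (hsmall : m * (N₀ * A₀ * (1 - ρ')⁻¹) ≤ 1 - sbar)
    {Bk : T4TermFormat.Booking} {T : Trajectory Bk} (c : ℕ → ℝ) (s₀ : Bk.Birth → ℕ → ℝ)
    (S : ℕ → Bk.Birth → Finset Bk.Birth)
    (hc0 : ∀ k, 0 ≤ c k) (hcb : ∀ k, k < Bk.K → c k ≤ cbar)
    (hS : ∀ k b, ∀ f ∈ S k b, Bk.birthScale f ≤ k)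
    (hcount : ∀ k b, ∀ j ≤ k, (((S k b).filter fun f => Bk.birthScale f = j).card : ℝ) ≤ N₀ * (L ^ 4) ^ (k - j))
    (hs₀ : ∀ b k, s₀ b k ≤ sbar)
    (hbirth : T.BirthsFromOld C (fun _ : ℕ => (L ^ 2)⁻¹ * a)
      (twoRate A₀ (rhoOneOf (L ^ 2)⁻¹ a C cbar) (L⁻¹ ^ 3) Bk.K) (budgetGate T s₀ m S C (fun _ : ℕ => (L ^ 2)⁻¹ * a)))
    (htr : T.TransportsFromVar C (fun _ : ℕ => (L ^ 2)⁻¹ * a) (budgetGate T s₀ m S C (fun _ : ℕ => (L ^ 2)⁻¹ * a)))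
    (hreg : T.RegeneratesFromVar c (budgetGate T s₀ m S C (fun _ : ℕ => (L ^ 2)⁻¹ * a))) :
    BookingLeaves (uniformConstantsOf L a C cbar N₀ A₀ m sbar ρ' hL ha hC hcbar hN₀ hA₀ hm hloc hρ'1 hsmall) Bk T where
  ρ := fun _ => (L ^ 2)⁻¹ * a
  c := c
  s₀ := s₀
  S := S
  hρ := fun _ => mul_nonneg (inv_nonneg.mpr (sq_nonneg L)) ha
  hc := hc0
  hrate := fun k hk => hrate_of hC (hcb k hk)
  hS := hS
  hcount := hcount
  hs₀ := hs₀
  hbirth := hbirth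
  htr := htr
  hreg := hreg

/-- **END-B OVER `uniformConstantsOf`** [bookkeeping]: one displayed number set and the per-cutoff leaves at every `(p, K)` ⟹
`DressedStability 𝒯` (`dressedStability_of_bookingLeaves` by name).  «NE1′ ⇐ the named binders». [folklore] -/
theorem dressedStability_of_stepFactor {P : Type*} (𝒯 : DressedTower P) {L a C cbar N₀ A₀ m sbar ρ' : ℝ} (hL : 1 ≤ L)
    (ha : 0 ≤ a) (hC : 0 ≤ C) (hcbar : 0 ≤ cbar) (hN₀ : 0 ≤ N₀) (hA₀ : 0 ≤ A₀) (hm : 0 ≤ m)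
    (hloc : locOf L a C cbar ≤ ρ') (hρ'1 : ρ' < 1) (hsmall : m * (N₀ * A₀ * (1 - ρ')⁻¹) ≤ 1 - sbar)
    (leaves : ∀ p K, BookingLeaves
      (uniformConstantsOf L a C cbar N₀ A₀ m sbar ρ' hL ha hC hcbar hN₀ hA₀ hm hloc hρ'1 hsmall) (𝒯.B p K) (𝒯.T p K)) :
    DressedStability 𝒯 :=
  dressedStability_of_bookingLeaves _ 𝒯 leaves

end Summit.QuantumFields.BalabanUV.T4Continuum.NE1p.DressedUniformConstants

end
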